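import Literature.Geometry.Riemannian.GaussianShrinker
import Literature.Geometry.Lorentzian.ConformalChangeRicci
import Literature.Geometry.Lorentzian.FlatChartComputations
import Literature.Geometry.Lorentzian.ModelData
import HarnessLib

/-!
# The round cylinder `S³(2) × ℝ` as the conformally flat metric `(4/|y|²) δ` on `ℝ⁴ ∖ {0}`:
# the metric and its curvature (topic `Geometry/Riemannian`)

The round cylinder of radius `2`, `S³(2) × ℝ` with `g = 4 g_{S³} + dz²`, is isometric to the
punctured space `ℝ⁴ ∖ {0}` with the conformally flat metric `g_c = (4/|y|²) δ = e^{2u} δ`,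
`u = log 2 − log |y|`, `z = 2 log |y|` (since `dt² + g_{S³} = ρ⁻²(dρ² + ρ² g_{S³})`, `ρ = eᵗ`). It is
the model non-compact gradient shrinking Ricci soliton of dimension four: with `f = z²/4 + 3/2`,
`Ric + Hess f = ½ g_c`, `R + |∇f|² = f`, `R = 3/2`, Gaussian density
`Θ(S³×ℝ) = (4π)⁻² ∫ e^{-f} dV = 2√π e^{-3/2} ≈ .791` (Cao–Hamilton–Ilmanen 2004, §4). This first
file builds the metric on the open submanifold `ℝ⁴ ∖ {0}` of `EuclideanFour` in the tree's
vocabulary and computes its curvature: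

* `punctured`, `P4` — `ℝ⁴ ∖ {0}` as an `Opens` / open submanifold; `uE` — the exponent
  `u = log 2 − ½ log |y|²` with `e^{2u} = 4/|y|²` (`exp_two_uE`) and its first and second
  derivatives (`fderiv_uE_apply`, `fderiv_fderiv_uE_apply`);
* `flatP`, `cylP` — the flat metric `δ` and the cylinder metric `g_c = e^{2u} δ` as smooth
  `PseudoRiemannianMetric`s on `P4` (sections of the bilinear-form bundle over an open subset,
  `OpensSection.contMDiff_bilinSection` of `ModelData.lean`), Riemannian, with Levi-Civita instances;
* the flat base in the identity chart: `ricci_flatP = 0`, `hessian_flatP = D²`, `dalembertian_flatP`,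
  `innerDual_flatP` (dictionary `ChartMetricCoord.lean` + `FlatChartComputations.lean`);
* **`ricci_cylP`** — `Ric(g_c)(Y,Z) = 2⟪Y,Z⟫/|x|² − 2⟪x,Y⟫⟪x,Z⟫/|x|⁴` (`= ½ g_c − ½ dz⊗dz`), by
  Besse's conformal law `OpensChart.ricci_conformalRepr_exp` (`ConformalChangeRicci.lean`);
* **`scalarCurvature_cylP`** — `R(g_c) = 3/2`.

The soliton potential, the weighted volume `∫ e^{-f} dV = 32π²√π e^{-3/2}` and completeness are in
the companion files `RoundCylinderFourSoliton.lean`, `RoundCylinderFourVolume.lean`. Everything is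
proved; no named facts. Written for the refuter's tightness lemma of crux
`EntropyRung.NoncompactShrinkerGap` (SmoothPoincare4): the bound of that crux is attained here.

## References

* H.-D. Cao, R. S. Hamilton, T. Ilmanen, *Gaussian densities and stability for some Ricci
  solitons*, arXiv:math/0404165 (2004), §4 (`Θ(S³×ℝ) = 2(π/e³)^{1/2} = .791`). [CaoHamiltonIlmanen2004]
* A. L. Besse, *Einstein manifolds*, Springer 1987, Thm. 1.159 (conformal changes). [Besse1987]
* P. Petersen, *Riemannian Geometry*, 3rd ed., Springer 2016, §4.2.3 (warped products / the
  cylinder as a conformally flat metric). [Petersen2016]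
-/

noncomputable section

open Bundle Set Function Filter Manifold Metric Module TopologicalSpace
open scoped Manifold ContDiff Topology RealInnerProductSpace ENNReal NNReal

namespace Literature.Geometry.Riemannian

open Lorentzian Lorentzian.PseudoRiemannianMetric

namespace RoundCylinderFour

/-! ### The punctured space `ℝ⁴ ∖ {0}` -/

/-- `ℝ⁴ ∖ {0}` as an open subset of `EuclideanFour = EuclideanSpace ℝ (Fin 4)`. [folklore] -/
def punctured : Opens EuclideanFour := ⟨{(0 : EuclideanFour)}ᶜ, isOpen_compl_singleton⟩

/-- `ℝ⁴ ∖ {0}` as a type (an open submanifold of `ℝ⁴`, charts = the inclusion). [folklore] -/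
abbrev P4 : Type := punctured

/-- Support lemma `coe_ne_zero` of the round-cylinder model `(ℝ⁴∖0, 4|y|⁻²δ)` (see the module docstring). [folklore] -/
theorem coe_ne_zero (y : P4) : (y : EuclideanFour) ≠ 0 := fun h ↦ y.2 (by
  rw [h]; exact rfl)

/-- Support lemma `norm_pos` of the round-cylinder model `(ℝ⁴∖0, 4|y|⁻²δ)` (see the module docstring). [folklore] -/
theorem norm_pos (y : P4) : 0 < ‖(y : EuclideanFour)‖ := norm_pos_iff.mpr (coe_ne_zero y)

/-- Support lemma `normSq_pos` of the round-cylinder model `(ℝ⁴∖0, 4|y|⁻²δ)` (see the module docstring). [folklore] -/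
theorem normSq_pos (y : P4) : 0 < ‖(y : EuclideanFour)‖ ^ 2 := pow_pos (norm_pos y) 2

/-! ### The conformal exponent `u(y) = log 2 − ½ log |y|²`, `e^{2u} = 4/|y|²` -/

/-- `u(y) = log 2 − ½ log |y|²` (total on `ℝ⁴`, junk at `0`). [folklore] -/
def uE (y : EuclideanFour) : ℝ := Real.log 2 - 2⁻¹ * Real.log (‖y‖ ^ 2)

/-- Support lemma `exp_two_uE` of the round-cylinder model `(ℝ⁴∖0, 4|y|⁻²δ)` (see the module docstring). [folklore] -/
theorem exp_two_uE {y : EuclideanFour} (hy : y ≠ 0) : Real.exp (2 * uE y) = 4 / ‖y‖ ^ 2 := by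
  have hy2 : 0 < ‖y‖ ^ 2 := pow_pos (norm_pos_iff.mpr hy) 2
  have h4 : Real.log 4 = 2 * Real.log 2 := by
    rw [show (4 : ℝ) = 2 ^ 2 by norm_num, Real.log_pow]; push_cast; ring
  have h : 2 * uE y = Real.log 4 - Real.log (‖y‖ ^ 2) := by
    rw [h4, uE]; ring
  rw [h, Real.exp_sub, Real.exp_log (by norm_num), Real.exp_log hy2]

/-- Support lemma `contDiffAt_uE` of the round-cylinder model `(ℝ⁴∖0, 4|y|⁻²δ)` (see the module docstring). [folklore] -/
theorem contDiffAt_uE {y : EuclideanFour} (hy : y ≠ 0) {n : ℕ∞ω} : ContDiffAt ℝ n uE y := by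
  have h1 : ContDiffAt ℝ n (fun y : EuclideanFour ↦ ‖y‖ ^ 2) y := (contDiff_norm_sq ℝ).contDiffAt
  have h2 : ContDiffAt ℝ n (fun y : EuclideanFour ↦ Real.log (‖y‖ ^ 2)) y := by
    exact (Real.contDiffAt_log.mpr (pow_pos (norm_pos_iff.mpr hy) 2).ne').comp y h1
  exact contDiffAt_const.sub (contDiffAt_const.mul h2)

/-- Support lemma `contDiffOn_uE` of the round-cylinder model `(ℝ⁴∖0, 4|y|⁻²δ)` (see the module docstring). [folklore] -/
theorem contDiffOn_uE {n : ℕ∞ω} : ContDiffOn ℝ n uE {y : EuclideanFour | y ≠ 0} :=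
  fun _ hy ↦ (contDiffAt_uE hy).contDiffWithinAt

/-! ### Calculus of `u`: first and second derivatives -/

/-- `du_y = −|y|⁻² ⟪y, ·⟫`. [folklore] -/
theorem hasFDerivAt_uE {y : EuclideanFour} (hy : y ≠ 0) :
    HasFDerivAt uE (-(‖y‖ ^ 2)⁻¹ • innerSL ℝ y) y := by
  have hy2 : ‖y‖ ^ 2 ≠ 0 := (pow_pos (norm_pos_iff.mpr hy) 2).ne'
  have h1 : HasFDerivAt (fun y : EuclideanFour ↦ ‖y‖ ^ 2) (2 • innerSL ℝ y) y :=
    (hasStrictFDerivAt_norm_sq y).hasFDerivAt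
  have h2 : HasFDerivAt (fun y : EuclideanFour ↦ Real.log (‖y‖ ^ 2))
      ((‖y‖ ^ 2)⁻¹ • (2 • innerSL ℝ y)) y := by
    exact (Real.hasDerivAt_log hy2).comp_hasFDerivAt y h1
  have h3 := (h2.const_mul (2⁻¹ : ℝ)).const_sub (Real.log 2)
  refine h3.congr_fderiv ?_
  ext v
  simp only [neg_apply, smul_apply, innerSL_apply_apply, smul_eq_mul, nsmul_eq_mul,
    Nat.cast_ofNat]
  field_simp

/-- Support lemma `fderiv_uE_apply` of the round-cylinder model `(ℝ⁴∖0, 4|y|⁻²δ)` (see the module docstring). [folklore] -/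
theorem fderiv_uE_apply {y : EuclideanFour} (hy : y ≠ 0) (v : EuclideanFour) :
    fderiv ℝ uE y v = -⟪y, v⟫ / ‖y‖ ^ 2 := by
  rw [(hasFDerivAt_uE hy).fderiv, smul_apply, innerSL_apply_apply, smul_eq_mul]
  ring

/-- The first derivative as a function, on `{y ≠ 0}`. [folklore] -/
theorem fderiv_uE_eventuallyEq {x : EuclideanFour} (hx : x ≠ 0) :
    fderiv ℝ uE =ᶠ[𝓝 x] fun y ↦ -(‖y‖ ^ 2)⁻¹ • innerSL ℝ y := by
  filter_upwards [isOpen_compl_singleton.mem_nhds hx] with y hy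
  exact (hasFDerivAt_uE hy).fderiv

/-- The derivative of `y ↦ −|y|⁻² ⟪y,·⟫` at `x`:
`Y ↦ (2⟪x,Y⟫/|x|⁴) ⟪x,·⟫ − |x|⁻² ⟪Y,·⟫`. [folklore] -/
theorem hasFDerivAt_duE {x : EuclideanFour} (hx : x ≠ 0) :
    HasFDerivAt (fun y : EuclideanFour ↦ -(‖y‖ ^ 2)⁻¹ • innerSL ℝ y)
      ((-(‖x‖ ^ 2)⁻¹) • (innerSL ℝ : EuclideanFour →L[ℝ] EuclideanFour →L[ℝ] ℝ) +
        (((‖x‖ ^ 2)⁻¹ ^ 2) • (2 • innerSL ℝ x)).smulRight (innerSL ℝ x)) x := by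
  have hx2 : ‖x‖ ^ 2 ≠ 0 := (pow_pos (norm_pos_iff.mpr hx) 2).ne'
  have h1 : HasFDerivAt (fun y : EuclideanFour ↦ ‖y‖ ^ 2) (2 • innerSL ℝ x) x :=
    (hasStrictFDerivAt_norm_sq x).hasFDerivAt
  have h2 : HasFDerivAt (fun y : EuclideanFour ↦ -(‖y‖ ^ 2)⁻¹)
      (((‖x‖ ^ 2)⁻¹ ^ 2) • (2 • innerSL ℝ x)) x := by
    have h := ((hasDerivAt_inv hx2).comp_hasFDerivAt x h1).neg
    refine h.congr_fderiv ?_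
    ext v
    simp only [neg_apply, smul_apply, smul_eq_mul, nsmul_eq_mul, Nat.cast_ofNat,
      innerSL_apply_apply]
    field_simp
  have h3 : HasFDerivAt (fun y : EuclideanFour ↦ (innerSL ℝ y : EuclideanFour →L[ℝ] ℝ))
      (innerSL ℝ : EuclideanFour →L[ℝ] EuclideanFour →L[ℝ] ℝ) x :=
    (innerSL ℝ : EuclideanFour →L[ℝ] EuclideanFour →L[ℝ] ℝ).hasFDerivAt
  exact h2.smul h3

/-- Support lemma `fderiv_fderiv_uE_apply` of the round-cylinder model `(ℝ⁴∖0, 4|y|⁻²δ)` (see the module docstring). [folklore] -/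
theorem fderiv_fderiv_uE_apply {x : EuclideanFour} (hx : x ≠ 0) (Y Z : EuclideanFour) :
    fderiv ℝ (fderiv ℝ uE) x Y Z = -⟪Y, Z⟫ / ‖x‖ ^ 2 + 2 * ⟪x, Y⟫ * ⟪x, Z⟫ / ‖x‖ ^ 4 := by
  rw [(fderiv_uE_eventuallyEq hx).fderiv_eq, (hasFDerivAt_duE hx).fderiv]
  simp only [add_apply, smul_apply, innerSL_apply_apply, smul_eq_mul,
    ContinuousLinearMap.smulRight_apply, nsmul_eq_mul, Nat.cast_ofNat]
  have e : (innerSL ℝ : EuclideanFour →L[ℝ] EuclideanFour →L[ℝ] ℝ) Y Z = ⟪Y, Z⟫ := rfl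
  rw [e]
  field_simp


/-! ### The flat metric `δ` and the cylinder metric `(4/|y|²) δ` on `ℝ⁴ ∖ {0}` -/

/-- Constant representative `δ`. [folklore] -/
abbrev G0 : EuclideanFour → EuclideanFour →L[ℝ] EuclideanFour →L[ℝ] ℝ :=
  fun _ ↦ innerSL ℝ (E := EuclideanFour)

/-- Representative `e^{2u} δ = (4/|y|²) δ` of the cylinder metric. [folklore] -/
abbrev Gc : EuclideanFour → EuclideanFour →L[ℝ] EuclideanFour →L[ℝ] ℝ :=
  fun y ↦ Real.exp (2 * uE y) • innerSL ℝ (E := EuclideanFour)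

/-- Support lemma `contDiffOn_Gc` of the round-cylinder model `(ℝ⁴∖0, 4|y|⁻²δ)` (see the module docstring). [folklore] -/
theorem contDiffOn_Gc : ContDiffOn ℝ ∞ Gc {y : EuclideanFour | y ≠ 0} :=
  contDiffOn_smul_const' (Real.contDiff_exp.comp_contDiffOn (contDiffOn_const.mul contDiffOn_uE))
    (innerSL ℝ (E := EuclideanFour))

/-- The fibre form of the flat metric: `δ_y = ⟪·,·⟫` on `T_y (ℝ⁴∖0) = ℝ⁴`. [folklore] -/
def flatInner (y : P4) :
    TangentSpace 𝓘(ℝ, EuclideanFour) y →L[ℝ] TangentSpace 𝓘(ℝ, EuclideanFour) y →L[ℝ] ℝ :=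
  show EuclideanFour →L[ℝ] EuclideanFour →L[ℝ] ℝ from innerSL ℝ (E := EuclideanFour)

/-- The fibre form of the cylinder metric: `(g_c)_y = e^{2u(y)} ⟪·,·⟫`. [folklore] -/
def cylInner (y : P4) :
    TangentSpace 𝓘(ℝ, EuclideanFour) y →L[ℝ] TangentSpace 𝓘(ℝ, EuclideanFour) y →L[ℝ] ℝ :=
  show EuclideanFour →L[ℝ] EuclideanFour →L[ℝ] ℝ from
    Real.exp (2 * uE (y : EuclideanFour)) • innerSL ℝ (E := EuclideanFour)

/-- Support lemma `flatInner_apply` of the round-cylinder model `(ℝ⁴∖0, 4|y|⁻²δ)` (see the module docstring). [folklore] -/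
@[simp] theorem flatInner_apply (y : P4) (v w : EuclideanFour) :
    flatInner y v w = ⟪v, w⟫ := rfl

/-- Support lemma `cylInner_apply` of the round-cylinder model `(ℝ⁴∖0, 4|y|⁻²δ)` (see the module docstring). [folklore] -/
@[simp] theorem cylInner_apply (y : P4) (v w : EuclideanFour) :
    cylInner y v w = Real.exp (2 * uE (y : EuclideanFour)) * ⟪v, w⟫ := rfl

/-- Support lemma `flatInner_eq` of the round-cylinder model `(ℝ⁴∖0, 4|y|⁻²δ)` (see the module docstring). [folklore] -/
theorem flatInner_eq (y : P4) : flatInner y = G0 y := rfl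
/-- Support lemma `cylInner_eq` of the round-cylinder model `(ℝ⁴∖0, 4|y|⁻²δ)` (see the module docstring). [folklore] -/
theorem cylInner_eq (y : P4) : cylInner y = Real.exp (2 * uE (y : EuclideanFour)) • G0 y := rfl

/-- The flat metric `δ` on `ℝ⁴ ∖ {0}`. [folklore] -/
def flatP : PseudoRiemannianMetric 𝓘(ℝ, EuclideanFour) ∞ EuclideanFour
    (TangentSpace 𝓘(ℝ, EuclideanFour) : P4 → Type _) where
  val := flatInner
  symm y v w := by
    change @inner ℝ EuclideanFour _ v w = @inner ℝ EuclideanFour _ w v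
    exact real_inner_comm _ _
  nondegenerate y v hv := by
    have h : @inner ℝ EuclideanFour _ v v = 0 := hv v
    exact inner_self_eq_zero.mp h
  contMDiff := OpensSection.contMDiff_bilinSection punctured _ contMDiff_const

/-- **The round cylinder metric** `g_c = (4/|y|²) δ` on `ℝ⁴ ∖ {0}` (`≅ S³(2) × ℝ` via
`y ↦ (y/|y|, 2 log |y|)`), spelled `e^{2u} δ`. [folklore] -/
def cylP : PseudoRiemannianMetric 𝓘(ℝ, EuclideanFour) ∞ EuclideanFour
    (TangentSpace 𝓘(ℝ, EuclideanFour) : P4 → Type _) where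
  val := cylInner
  symm y v w := by
    change Real.exp (2 * uE y) * @inner ℝ EuclideanFour _ v w =
      Real.exp (2 * uE y) * @inner ℝ EuclideanFour _ w v
    rw [real_inner_comm]
  nondegenerate y v hv := by
    have h : Real.exp (2 * uE y) * @inner ℝ EuclideanFour _ v v = 0 := hv v
    rcases mul_eq_zero.mp h with h | h
    · exact absurd h (Real.exp_pos _).ne'
    · exact inner_self_eq_zero.mp h
  contMDiff := by
    refine OpensSection.contMDiff_bilinSection punctured (fun y ↦ Gc y) ?_
    exact contDiffOn_Gc.contMDiffOn.comp_contMDiff contMDiff_subtype_val fun y ↦ coe_ne_zero y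

/-- Support lemma `flatP_val` of the round-cylinder model `(ℝ⁴∖0, 4|y|⁻²δ)` (see the module docstring). [folklore] -/
theorem flatP_val (y : P4) : flatP.val y = G0 y := rfl
/-- Support lemma `cylP_val` of the round-cylinder model `(ℝ⁴∖0, 4|y|⁻²δ)` (see the module docstring). [folklore] -/
theorem cylP_val (y : P4) : cylP.val y = Real.exp (2 * uE (y : EuclideanFour)) • G0 y := rfl

/-- Support lemma `flatP_apply` of the round-cylinder model `(ℝ⁴∖0, 4|y|⁻²δ)` (see the module docstring). [folklore] -/
theorem flatP_apply (y : P4) (v w : EuclideanFour) : flatP.val y v w = ⟪v, w⟫ := rfl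

/-- Support lemma `cylP_apply` of the round-cylinder model `(ℝ⁴∖0, 4|y|⁻²δ)` (see the module docstring). [folklore] -/
theorem cylP_apply (y : P4) (v w : EuclideanFour) :
    cylP.val y v w = 4 / ‖(y : EuclideanFour)‖ ^ 2 * ⟪v, w⟫ := by
  change Real.exp (2 * uE y) * ⟪v, w⟫ = _
  rw [exp_two_uE (coe_ne_zero y)]

/-- Support lemma `isRiemannian_cylP` of the round-cylinder model `(ℝ⁴∖0, 4|y|⁻²δ)` (see the module docstring). [folklore] -/
theorem isRiemannian_cylP : cylP.IsRiemannian := fun y v hv ↦ by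
  rw [cylP_apply]
  exact mul_pos (div_pos (by norm_num) (normSq_pos y)) (real_inner_self_pos.mpr hv)

/-- Support lemma `isRiemannian_flatP` of the round-cylinder model `(ℝ⁴∖0, 4|y|⁻²δ)` (see the module docstring). [folklore] -/
theorem isRiemannian_flatP : flatP.IsRiemannian := fun y v hv ↦ by
  rw [flatP_apply]; exact real_inner_self_pos.mpr hv

/-- Support lemma `instance` of the round-cylinder model `(ℝ⁴∖0, 4|y|⁻²δ)` (see the module docstring). [folklore] -/
instance : flatP.HasLeviCivita := flatP.hasLeviCivita
/-- Support lemma `instance` of the round-cylinder model `(ℝ⁴∖0, 4|y|⁻²δ)` (see the module docstring). [folklore] -/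
instance : cylP.HasLeviCivita := cylP.hasLeviCivita

/-! ### Flat base: `Ric(δ) = 0`, `Hess_δ = D²`, `Δ_δ = Σ ∂ᵢ∂ᵢ`, `δ⁻¹(α,β) = Σ α(eᵢ)β(eᵢ)` -/

/-- The standard basis of `ℝ⁴`. [folklore] -/
abbrev e4 : Module.Basis (Fin 4) ℝ EuclideanFour := (EuclideanSpace.basisFun (Fin 4) ℝ).toBasis

/-- Support lemma `e4_apply` of the round-cylinder model `(ℝ⁴∖0, 4|y|⁻²δ)` (see the module docstring). [folklore] -/
theorem e4_apply (i : Fin 4) : e4 i = EuclideanSpace.single i 1 := by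
  simp [e4]

/-- Support lemma `ricci_flatP` of the round-cylinder model `(ℝ⁴∖0, 4|y|⁻²δ)` (see the module docstring). [folklore] -/
theorem ricci_flatP (x : P4) (Y Z : EuclideanFour) : flatP.ricci x Y Z = 0 := by
  rw [OpensChart.ricci_eq_ricAt flatP_val x, MetricCoord.ricAt_constMetric]
  rfl

/-- Support lemma `hessian_flatP` of the round-cylinder model `(ℝ⁴∖0, 4|y|⁻²δ)` (see the module docstring). [folklore] -/
theorem hessian_flatP (x : P4) {f : P4 → ℝ} {Φ : EuclideanFour → ℝ} (hf : ∀ y : P4, f y = Φ y)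
    (hΦ : ContDiffAt ℝ 2 Φ x) (Y Z : EuclideanFour) :
    flatP.hessian f x Y Z = fderiv ℝ (fderiv ℝ Φ) x Y Z := by
  rw [OpensChart.hessian_eq_hessAt flatP_val x hf hΦ, MetricCoord.hessAt_constMetric]

/-- Support lemma `dalembertian_flatP` of the round-cylinder model `(ℝ⁴∖0, 4|y|⁻²δ)` (see the module docstring). [folklore] -/
theorem dalembertian_flatP (x : P4) {f : P4 → ℝ} {Φ : EuclideanFour → ℝ}
    (hf : ∀ y : P4, f y = Φ y) (hΦ : ContDiffAt ℝ 2 Φ x) :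
    flatP.dalembertian f x = ∑ i, fderiv ℝ (fderiv ℝ Φ) x (e4 i) (e4 i) := by
  rw [OpensChart.dalembertian_eq_lapAt flatP_val x hf hΦ,
    MetricCoord.lapAt_constMetric _ e4 innerSL_basisFun_orthonormal]

/-- Support lemma `innerDual_flatP` of the round-cylinder model `(ℝ⁴∖0, 4|y|⁻²δ)` (see the module docstring). [folklore] -/
theorem innerDual_flatP (x : P4) (α β : EuclideanFour →L[ℝ] ℝ) :
    flatP.innerDual x (α : EuclideanFour →ₗ[ℝ] ℝ) (β : EuclideanFour →ₗ[ℝ] ℝ) =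
      ∑ i, α (e4 i) * β (e4 i) := by
  rw [OpensChart.innerDual_eq_sharpAt flatP_val x,
    MetricCoord.apply_sharpAt_constMetric _ e4 innerSL_basisFun_orthonormal
      (fun v w ↦ real_inner_comm w v)]

/-! ### Sums over the standard basis -/

/-- Support lemma `sum_inner_e4_sq` of the round-cylinder model `(ℝ⁴∖0, 4|y|⁻²δ)` (see the module docstring). [folklore] -/
theorem sum_inner_e4_sq (x : EuclideanFour) : ∑ i, ⟪x, e4 i⟫ ^ 2 = ‖x‖ ^ 2 := by
  simp only [e4_apply, EuclideanSpace.inner_single_right, EuclideanSpace.norm_sq_eq]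
  simp

/-- Support lemma `sum_inner_e4_e4` of the round-cylinder model `(ℝ⁴∖0, 4|y|⁻²δ)` (see the module docstring). [folklore] -/
theorem sum_inner_e4_e4 : ∑ i : Fin 4, ⟪(e4 i : EuclideanFour), e4 i⟫ = 4 := by
  simp [e4_apply]

/-- Support lemma `sum_inner_mul_inner_e4` of the round-cylinder model `(ℝ⁴∖0, 4|y|⁻²δ)` (see the module docstring). [folklore] -/
theorem sum_inner_mul_inner_e4 (x Y : EuclideanFour) : ∑ i, ⟪x, e4 i⟫ * ⟪Y, e4 i⟫ = ⟪x, Y⟫ := by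
  simp only [e4_apply, EuclideanSpace.inner_single_right]
  simp [EuclideanSpace.inner_eq_star_dotProduct, dotProduct, mul_comm]


/-! ### The conformal exponent as a function on `ℝ⁴ ∖ {0}` -/

/-- `u` on the punctured space. [folklore] -/
def wP (y : P4) : ℝ := uE y

/-- Support lemma `wP_eq` of the round-cylinder model `(ℝ⁴∖0, 4|y|⁻²δ)` (see the module docstring). [folklore] -/
theorem wP_eq (y : P4) : wP y = uE y := rfl

/-- Support lemma `mvfderiv_wP` of the round-cylinder model `(ℝ⁴∖0, 4|y|⁻²δ)` (see the module docstring). [folklore] -/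
theorem mvfderiv_wP (x : P4) (v : EuclideanFour) :
    mvfderiv 𝓘(ℝ, EuclideanFour) wP x v = -⟪(x : EuclideanFour), v⟫ / ‖(x : EuclideanFour)‖ ^ 2 := by
  rw [OpensChart.mvfderiv_eq x wP uE wP_eq ((hasFDerivAt_uE (coe_ne_zero x)).differentiableAt) v,
    fderiv_uE_apply (coe_ne_zero x)]

/-- Support lemma `laplacian_uE` of the round-cylinder model `(ℝ⁴∖0, 4|y|⁻²δ)` (see the module docstring). [folklore] -/
theorem laplacian_uE (x : P4) :
    ∑ i, fderiv ℝ (fderiv ℝ uE) x (e4 i) (e4 i) = -2 / ‖(x : EuclideanFour)‖ ^ 2 := by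
  have hx := coe_ne_zero x
  have hn : ‖(x : EuclideanFour)‖ ≠ 0 := (norm_pos x).ne'
  have h : ∀ i, fderiv ℝ (fderiv ℝ uE) x (e4 i) (e4 i) =
      -(1 / ‖(x : EuclideanFour)‖ ^ 2) * ⟪(e4 i : EuclideanFour), e4 i⟫ +
        (2 / ‖(x : EuclideanFour)‖ ^ 4) * ⟪(x : EuclideanFour), e4 i⟫ ^ 2 := by
    intro i; rw [fderiv_fderiv_uE_apply hx]; ring
  simp_rw [h, Finset.sum_add_distrib, ← Finset.mul_sum, sum_inner_e4_e4, sum_inner_e4_sq]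
  field_simp
  ring

/-- Support lemma `gradnormSq_uE` of the round-cylinder model `(ℝ⁴∖0, 4|y|⁻²δ)` (see the module docstring). [folklore] -/
theorem gradnormSq_uE (x : P4) :
    ∑ i, fderiv ℝ uE x (e4 i) * fderiv ℝ uE x (e4 i) = 1 / ‖(x : EuclideanFour)‖ ^ 2 := by
  have hx := coe_ne_zero x
  have hn : ‖(x : EuclideanFour)‖ ≠ 0 := (norm_pos x).ne'
  have h : ∀ i, fderiv ℝ uE x (e4 i) * fderiv ℝ uE x (e4 i) =
      (1 / ‖(x : EuclideanFour)‖ ^ 4) * ⟪(x : EuclideanFour), e4 i⟫ ^ 2 := by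
    intro i; rw [fderiv_uE_apply hx]; ring
  simp_rw [h, ← Finset.mul_sum, sum_inner_e4_sq]
  field_simp

/-! ### The Ricci tensor of the cylinder: `Ric(g_c)(Y,Z) = 2⟪Y,Z⟫/|x|² − 2⟪x,Y⟫⟪x,Z⟫/|x|⁴`,
i.e. `Ric = ½ g_c − ½ dz ⊗ dz` with `dz = 2⟪x,·⟫/|x|²` -/

/-- **The Ricci tensor of the round cylinder** `g_c = (4/|y|²) δ`:
`Ric(g_c)_x(Y,Z) = 2⟪Y,Z⟫/|x|² − 2⟪x,Y⟫⟪x,Z⟫/|x|⁴`, i.e. `Ric = ½ g_c − ½ dz ⊗ dz` with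
`dz = 2⟪x,·⟫/|x|²` (the `S³(2)` factor is Einstein with `Ric = ½ g`, the `ℝ` factor is flat);
from Besse's conformal law (Thm. 1.159 (d)) applied to `g_c = e^{2u} δ`. [cite: Besse1987, Thm. 1.159 (d)] -/
theorem ricci_cylP (x : P4) (Y Z : EuclideanFour) :
    cylP.ricci x Y Z =
      2 * ⟪Y, Z⟫ / ‖(x : EuclideanFour)‖ ^ 2 -
        2 * ⟪(x : EuclideanFour), Y⟫ * ⟪(x : EuclideanFour), Z⟫ / ‖(x : EuclideanFour)‖ ^ 4 := by
  have hx := coe_ne_zero x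
  have hρ : ‖(x : EuclideanFour)‖ ^ 2 ≠ 0 := (normSq_pos x).ne'
  have hu : ContDiffOn ℝ ∞ uE (punctured : Set EuclideanFour) := contDiffOn_uE
  have h := OpensChart.ricci_conformalRepr_exp flatP_val cylP_val hu (w := wP) wP_eq x Y Z
  rw [h, ricci_flatP, hessian_flatP x wP_eq (contDiffAt_uE hx), fderiv_fderiv_uE_apply hx,
    mvfderiv_wP, mvfderiv_wP, dalembertian_flatP x wP_eq (contDiffAt_uE hx), laplacian_uE]
  have hmv : (mvfderiv 𝓘(ℝ, EuclideanFour) wP x).toLinearMap =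
      ((fderiv ℝ uE x : EuclideanFour →L[ℝ] ℝ) : EuclideanFour →ₗ[ℝ] ℝ) := by
    apply LinearMap.ext; intro v
    exact OpensChart.mvfderiv_eq x wP uE wP_eq ((hasFDerivAt_uE hx).differentiableAt) v
  rw [hmv, innerDual_flatP, gradnormSq_uE, flatP_apply, finrank_euclideanSpace_fin]
  push_cast
  field_simp
  ring


/-! ### Scalar curvature `R(g_c) = 3/2` -/

/-- Support lemma `scalarCurvature_flatP` of the round-cylinder model `(ℝ⁴∖0, 4|y|⁻²δ)` (see the module docstring). [folklore] -/
theorem scalarCurvature_flatP (x : P4) : flatP.scalarCurvature x = 0 := by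
  rw [OpensChart.scalarCurvature_eq_scalAt flatP_val x, MetricCoord.scalAt_constMetric]

/-- Support lemma `scalarCurvature_cylP` of the round-cylinder model `(ℝ⁴∖0, 4|y|⁻²δ)` (see the module docstring). [folklore] -/
theorem scalarCurvature_cylP (x : P4) : cylP.scalarCurvature x = 3 / 2 := by
  have hx := coe_ne_zero x
  have hρ : ‖(x : EuclideanFour)‖ ^ 2 ≠ 0 := (normSq_pos x).ne'
  have hu : ContDiffOn ℝ ∞ uE (punctured : Set EuclideanFour) := contDiffOn_uE
  have h := OpensChart.scalarCurvature_conformalRepr_exp flatP_val cylP_val hu (w := wP) wP_eq x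
  have hmv : (mvfderiv 𝓘(ℝ, EuclideanFour) wP x).toLinearMap =
      ((fderiv ℝ uE x : EuclideanFour →L[ℝ] ℝ) : EuclideanFour →ₗ[ℝ] ℝ) := by
    apply LinearMap.ext; intro v
    exact OpensChart.mvfderiv_eq x wP uE wP_eq ((hasFDerivAt_uE hx).differentiableAt) v
  rw [h, scalarCurvature_flatP, dalembertian_flatP x wP_eq (contDiffAt_uE hx), laplacian_uE, hmv,
    innerDual_flatP, gradnormSq_uE, finrank_euclideanSpace_fin, wP_eq, exp_two_uE hx]
  push_cast
  field_simp
  ring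

end RoundCylinderFour

end Literature.Geometry.Riemannian

end
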